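import Summits.PneNP.PneNP.Theses.OneSlice
import Literature.Computability.Complexity.RossmanMonotoneClique
import Literature.Computability.Complexity.Rossman2008CliqueProofs
import Literature.Computability.Complexity.CircuitLowerBoundsProofs

/-!
# `SingleThreshold` (stmt-PneNP-2833, route PneNP/OneSlice) — negative-side lemmas I: load-bearing
hypotheses and tightness of the witnesses `(k, δ)`

Standing-adversary (cdisprove) output for the crux
`Summit.PneNP.PneNP.Theses.OneSlice.SingleThreshold`:
`∀ c ∃ k ≥ 3 ∃ δ > 0 ∀ᶠ n, every {∧₂,∨₂}-circuit C on the edges of K_n with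
Pr_{G(n, n^{-2/(k-1)})}[C ≠ CLIQUE_k] ≤ δ has n^c < |C|`. The crux is NOT refuted and NOT mis-stated
(it is equivalent to Rossman's open single-threshold problem, FOCS 2010 §9, unbounded-exponent a.a.s.
form — `EquivAAS.lean`); this file records, as theorems, what any proof must use:

* §0 `singleThreshold_iff_lib` — the route's inlined statement is definitionally
  `∀ c ∃ k ≥ 3 ∃ δ > 0, LowerBoundAt c k δ` over the library's `gnpProb` / `cliqueFn`.
* §1 `singleThreshold_false_without_basis` (one table gate), `singleThreshold_false_without_accuracy`
  (the gate-free circuit `x_e`): both hypotheses on `C` are load-bearing.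
* §2 `err_input_le_pc`, `witness_delta_le` — `x_e` errs w.p. ≤ `p_c + 1/k!`, so EVERY witness
  `(k, δ)` (at any exponent) has `δ ≤ 1/k!`; `not_singleThresholdDeltaBeforeK` — `δ` chosen before
  `k` (uniform in `k`) is FALSE.
* §3 `exists_monotone_cliqueCircuit` (exact DNF, size ≤ `C(n,k)(C(k,2)+1)`), `witness_exponent_lt` —
  EVERY witness `k` at exponent `c` has `c ≤ k + 1`; `not_singleThresholdKBeforeC` — one `k` for all
  `c` is FALSE.

Companions: `EquivAAS.lean` (fixed-δ ⇔ a.a.s.), `Density.lean` (sub/supercritical densities kill it).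
Refuter seat cdisprove-stmt-PneNP-2833 (gen 1), 2026-08-16.
-/

namespace Summit.PneNP.PneNP.Theorems.SingleThreshold.Negative

open Literature.Computability.Complexity Finset Filter Classical
open Summit.PneNP.PneNP.Theses.OneSlice (SingleThreshold)

noncomputable section


/-- The edge set of `K_n` (input positions). [folklore] -/
abbrev Edges (n : ℕ) : Type := ((⊤ : SimpleGraph (Fin n)).edgeSet)

/-- The critical density `p = n^{-2/(k-1)}` of the crux. [folklore] -/
def pc (n k : ℕ) : ℝ := (n : ℝ) ^ (-(2 : ℝ) / ((k : ℝ) - 1))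

/-- The error probability of `C` for `k`-CLIQUE on `G(n, p_c)`, in library vocabulary. [folklore] -/
def err (n k : ℕ) (C : Circuit (Edges n)) : ℝ :=
  gnpProb n (pc n k) (univ.filter fun x => C.eval x ≠ cliqueFn n k x)

/-- The crux's matrix at exponent `c`, clique size `k`, accuracy `δ`: eventually in `n`, every
`δ`-accurate monotone circuit has more than `n^c` gates (library vocabulary `gnpProb`, `cliqueFn`);
the crux is `∀ c, ∃ k ≥ 3, ∃ δ > 0, LowerBoundAt c k δ` (`singleThreshold_iff_lib`). [folklore] -/
def LowerBoundAt (c k : ℕ) (δ : ℝ) : Prop :=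
  ∀ᶠ n : ℕ in atTop, ∀ C : Circuit (Edges n), C.IsOver monotoneBasis → err n k C ≤ δ → n ^ c < C.size

/-- The route's inlined statement IS the library statement, definitionally. [folklore] -/
theorem singleThreshold_iff_lib :
    SingleThreshold ↔ ∀ c : ℕ, ∃ k : ℕ, 3 ≤ k ∧ ∃ δ : ℝ, 0 < δ ∧ LowerBoundAt c k δ := Iff.rfl

/-! ## §1 Load-bearing hypotheses -/

/-- A one-gate "truth-table" circuit: a single gate of fan-in `|ι|` whose truth table is `f`. [folklore] -/
def tableCircuit {ι : Type} [Fintype ι] (f : (ι → Bool) → Bool) : Circuit ι where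
  gates := [⟨Fintype.card ι, fun v => f (fun i => v (Fintype.equivFin ι i)),
    fun a => Sum.inl ((Fintype.equivFin ι).symm a)⟩]
  output := .inr 0
  wf := by
    intro j hj a m hm
    simp only [List.length_singleton, Nat.lt_one_iff] at hj
    subst hj
    simp at hm
  wf_output := by
    intro m hm
    cases hm
    simp

/-- The table circuit has one gate. [folklore] -/
theorem tableCircuit_size {ι : Type} [Fintype ι] (f : (ι → Bool) → Bool) :
    (tableCircuit f).size = 1 := rfl

/-- The table circuit computes its truth table. [folklore] -/
theorem tableCircuit_eval {ι : Type} [Fintype ι] (f : (ι → Bool) → Bool) (x : ι → Bool) :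
    (tableCircuit f).eval x = f x := by
  simp [tableCircuit, Circuit.eval, Circuit.wireVals]

/-- **The basis restriction is load-bearing.** The crux with `C.IsOver monotoneBasis` DROPPED
(gates of any truth table and fan-in) is FALSE: a single fan-in-`C(n,2)` gate computes `CLIQUE_k`
exactly (error `0`, size `1 = n^0`). [folklore] -/
theorem singleThreshold_false_without_basis :
    ¬ ∀ c : ℕ, ∃ k : ℕ, 3 ≤ k ∧ ∃ δ : ℝ, 0 < δ ∧ ∀ᶠ n : ℕ in atTop,
      ∀ C : Circuit (Edges n), err n k C ≤ δ → n ^ c < C.size := by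
  intro h
  obtain ⟨k, -, δ, hδ, hev⟩ := h 0
  obtain ⟨n, hn⟩ := hev.exists
  have h1 := hn (tableCircuit (cliqueFn n k)) ?_
  · simp [tableCircuit_size] at h1
  · have : (univ.filter fun x => (tableCircuit (cliqueFn n k)).eval x ≠ cliqueFn n k x) = ∅ := by
      simp [tableCircuit_eval]
    simp [err, this, gnpProb, hδ.le]

/-- An edge of `K_n`, `n ≥ 2`. [folklore] -/
def e01 (n : ℕ) (hn : 2 ≤ n) : Edges n :=
  ⟨s(⟨0, by omega⟩, ⟨1, by omega⟩), by
    rw [SimpleGraph.mem_edgeSet, SimpleGraph.top_adj]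
    simp⟩

/-- **The accuracy hypothesis is load-bearing.** The crux with `err ≤ δ` DROPPED is FALSE: the
gate-free circuit `x_e` is monotone of size `0`. [folklore] -/
theorem singleThreshold_false_without_accuracy :
    ¬ ∀ c : ℕ, ∃ k : ℕ, 3 ≤ k ∧ ∃ δ : ℝ, 0 < δ ∧ ∀ᶠ n : ℕ in atTop,
      ∀ C : Circuit (Edges n), C.IsOver monotoneBasis → n ^ c < C.size := by
  intro h
  obtain ⟨k, -, δ, -, hev⟩ := h 0
  obtain ⟨n, hn, hn2⟩ := (hev.and (eventually_ge_atTop 2)).exists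
  have h1 := hn (Circuit.input (e01 n hn2)) (fun g hg => by simp [Circuit.input] at hg)
  simp at h1

/-! ## §2 Tightness in `δ`: every witness `(k, δ)` has `δ ≤ 1/k!` -/

/-- Union bound for `G(n,q)`-probabilities. [folklore] -/
theorem gnpProb_union_le {n : ℕ} {q : ℝ} (hq0 : 0 ≤ q) (hq1 : q ≤ 1)
    (A B : Finset (Edges n → Bool)) :
    gnpProb n q (A ∪ B) ≤ gnpProb n q A + gnpProb n q B := by
  have h := Finset.sum_union_inter (s₁ := A) (s₂ := B) (f := gnpWeight n q)
  have h0 : 0 ≤ gnpProb n q (A ∩ B) := gnpProb_nonneg hq0 hq1 _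
  unfold gnpProb at *
  linarith

/-- `Pr[x_e = 1] = q`. [folklore] -/
theorem gnpProb_coord_true {n : ℕ} (q : ℝ) (e : Edges n) :
    gnpProb n q (univ.filter fun x : Edges n → Bool => x e = true) = q := by
  have h := sum_gnpWeight_filter_forall (n := n) q {e}
  simp only [mem_singleton, forall_eq, card_singleton, pow_one] at h
  exact h

/-- The error of the gate-free circuit `x_e` at density `q`: at most
`Pr[x_e = 1] + Pr[ω_k ≥ 1] ≤ q + C(n,k) q^{C(k,2)}` (first moment). [folklore] -/
theorem err_input_le {n k : ℕ} (e : Edges n) {q : ℝ} (hq0 : 0 ≤ q) (hq1 : q ≤ 1) :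
    gnpProb n q (univ.filter fun x => (Circuit.input e).eval x ≠ cliqueFn n k x)
      ≤ q + (n.choose k : ℝ) * q ^ (k.choose 2) := by
  have hsub : (univ.filter fun x : Edges n → Bool => (Circuit.input e).eval x ≠ cliqueFn n k x) ⊆
      (univ.filter fun x : Edges n → Bool => x e = true) ∪
        (univ.filter fun x => cliqueFn n k x = true) := by
    intro x hx
    simp only [mem_filter, mem_univ, true_and, Circuit.eval_input] at hx
    simp only [mem_union, mem_filter, mem_univ, true_and]
    revert hx
    cases x e <;> cases cliqueFn n k x <;> simp
  calc gnpProb n q (univ.filter fun x => (Circuit.input e).eval x ≠ cliqueFn n k x)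
      ≤ gnpProb n q ((univ.filter fun x : Edges n → Bool => x e = true) ∪
          (univ.filter fun x => cliqueFn n k x = true)) := gnpProb_mono hq0 hq1 hsub
    _ ≤ gnpProb n q (univ.filter fun x : Edges n → Bool => x e = true) +
          gnpProb n q (univ.filter fun x => cliqueFn n k x = true) := gnpProb_union_le hq0 hq1 _ _
    _ ≤ q + (n.choose k : ℝ) * q ^ (k.choose 2) := by
        rw [gnpProb_coord_true]
        exact add_le_add le_rfl (gnpProb_clique_le hq0 hq1 k)

/-- `0 ≤ p_c`. [folklore] -/
theorem pc_nonneg (n k : ℕ) : 0 ≤ pc n k := Real.rpow_nonneg (Nat.cast_nonneg n) _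

/-- `p_c ≤ 1` for `n ≥ 1`, `k ≥ 2`. [folklore] -/
theorem pc_le_one {n k : ℕ} (hn : 1 ≤ n) (hk : 2 ≤ k) : pc n k ≤ 1 := by
  unfold pc
  apply Real.rpow_le_one_of_one_le_of_nonpos (by exact_mod_cast hn)
  have hk' : (2 : ℝ) ≤ k := by exact_mod_cast hk
  exact div_nonpos_of_nonpos_of_nonneg (by norm_num) (by linarith)

/-- At the critical density the first moment is `C(n,k) · p_c^{C(k,2)} = C(n,k) n^{-k} ≤ 1/k!`.
[folklore] -/
theorem firstMoment_pc_le {n k : ℕ} (hn : 1 ≤ n) (hk : 2 ≤ k) :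
    (n.choose k : ℝ) * pc n k ^ (k.choose 2) ≤ 1 / (k.factorial : ℝ) := by
  have hn0 : (0 : ℝ) < n := by exact_mod_cast hn
  have hk1 : (k : ℝ) - 1 ≠ 0 := by
    have : (2 : ℝ) ≤ k := by exact_mod_cast hk
    linarith
  have hpow : pc n k ^ (k.choose 2) = ((n : ℝ) ^ k)⁻¹ := by
    unfold pc
    rw [← Real.rpow_natCast, ← Real.rpow_mul hn0.le, Nat.cast_choose_two]
    have : -2 / ((k : ℝ) - 1) * ((k : ℝ) * ((k : ℝ) - 1) / 2) = -(k : ℝ) := by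
      field_simp
    rw [this, Real.rpow_neg hn0.le, Real.rpow_natCast]
  rw [hpow]
  have hc : (n.choose k : ℝ) ≤ ((n : ℝ) ^ k) / (k.factorial : ℝ) := Nat.choose_le_pow_div k n
  have hnk : (0 : ℝ) < (n : ℝ) ^ k := pow_pos hn0 k
  calc (n.choose k : ℝ) * ((n : ℝ) ^ k)⁻¹ ≤ ((n : ℝ) ^ k / (k.factorial : ℝ)) * ((n : ℝ) ^ k)⁻¹ :=
        mul_le_mul_of_nonneg_right hc (inv_nonneg.2 hnk.le)
    _ = 1 / (k.factorial : ℝ) := by field_simp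

/-- **Tightness in `δ`.** The size-`0` monotone circuit `x_e` has error at most
`p_c + 1/k!` on `G(n, p_c)`. [folklore] -/
theorem err_input_le_pc {n k : ℕ} (hn : 1 ≤ n) (hk : 2 ≤ k) (e : Edges n) :
    err n k (Circuit.input e) ≤ pc n k + 1 / (k.factorial : ℝ) :=
  (err_input_le e (pc_nonneg n k) (pc_le_one hn hk)).trans
    (add_le_add le_rfl (firstMoment_pc_le hn hk))

/-- `p_c = n^{-2/(k-1)} → 0` for `k ≥ 2`. [folklore] -/
theorem tendsto_pc {k : ℕ} (hk : 2 ≤ k) : Tendsto (fun n => pc n k) atTop (nhds 0) := by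
  have hpos : 0 < (2 : ℝ) / ((k : ℝ) - 1) := by
    have hk' : (2 : ℝ) ≤ k := by exact_mod_cast hk
    exact div_pos two_pos (by linarith)
  have h1 := (tendsto_rpow_neg_atTop hpos).comp tendsto_natCast_atTop_atTop
  refine h1.congr fun n => ?_
  simp only [Function.comp_apply, pc, neg_div]

/-- **Every witness has `δ ≤ 1/k!`.** If `(k, δ)` witnesses the crux at some exponent `c`
(indeed at any `c`), then `δ ≤ 1/k!`: otherwise the size-`0` circuit `x_e` is `δ`-accurate for
all large `n`. So the `∃ δ` of the crux necessarily shrinks like `1/k!` (the true scale is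
`Pr[ω_k ≥ 1] → 1 - e^{-1/k!}`). [folklore] -/
theorem witness_delta_le {c k : ℕ} {δ : ℝ} (hk : 2 ≤ k) (h : LowerBoundAt c k δ) :
    δ ≤ 1 / (k.factorial : ℝ) := by
  by_contra hlt
  push Not at hlt
  have hε : 0 < δ - 1 / (k.factorial : ℝ) := by linarith
  have hev := (tendsto_pc hk).eventually (eventually_le_nhds hε)
  obtain ⟨n, hn, hpc, hn2⟩ := (h.and (hev.and (eventually_ge_atTop 2))).exists
  have herr : err n k (Circuit.input (e01 n hn2)) ≤ δ := by
    have := err_input_le_pc (by omega) hk (e01 n hn2)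
    linarith
  have := hn (Circuit.input (e01 n hn2)) (fun g hg => by simp [Circuit.input] at hg) herr
  simp at this

/-- **Natural strengthening no. 1 — `δ` chosen BEFORE `k` (uniformly in `k`) — is FALSE**: a `δ`
uniform in `k` is beaten by `x_e` once `1/k! < δ`. [folklore] -/
theorem not_singleThresholdDeltaBeforeK :
    ¬ ∀ c : ℕ, ∃ δ : ℝ, 0 < δ ∧ ∀ k : ℕ, 3 ≤ k → LowerBoundAt c k δ := by
  intro h
  obtain ⟨δ, hδ, H⟩ := h 0
  -- a clique size with `1/k! < δ`
  obtain ⟨k₀, hk₀⟩ := exists_nat_gt (1 / δ)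
  set k := max 3 k₀ with hk
  have hk3 : 3 ≤ k := le_max_left _ _
  have hkδ : 1 / (k.factorial : ℝ) < δ := by
    have h1 : (k₀ : ℝ) ≤ k := by exact_mod_cast le_max_right 3 k₀
    have h2 : (k : ℝ) ≤ k.factorial := by exact_mod_cast Nat.self_le_factorial k
    have h3 : 1 / δ < (k.factorial : ℝ) := by linarith
    have h4 : 0 < (k.factorial : ℝ) := by positivity
    rw [div_lt_iff₀ h4]
    rw [div_lt_iff₀ hδ] at h3
    linarith
  exact absurd (witness_delta_le (by omega) (H k hk3)) (not_le.2 hkδ)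

/-! ## §3 Tightness in `k`: every witness `k` at exponent `c` has `c ≤ k + 1` -/

/-- **The exact monotone clique circuit with its size.** For `2 ≤ k ≤ n`, the OR over all
`k`-sets `S` of the AND of the `C(k,2)` edges inside `S` is a `{∧₂, ∨₂}`-circuit of size at most
`C(n,k) · (C(k,2) + 1)` computing `CLIQUE_k` exactly (the library's
`exists_monotone_computes_cliqueFn_holds`, with the size bookkeeping kept). [folklore] -/
theorem exists_monotone_cliqueCircuit {n k : ℕ} (h2 : 2 ≤ k) (hkn : k ≤ n) :
    ∃ C : Circuit (Edges n), C.IsOver monotoneBasis ∧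
      C.size ≤ n.choose k * (k.choose 2 + 1) ∧ ∀ x, C.eval x = cliqueFn n k x := by
  classical
  set T : Finset (Finset (Fin n)) := powersetCard k univ with hT
  let E : Finset (Fin n) → List (Edges n) := fun S => (univ.filter fun e => IsLive S e).toList
  have hElen : ∀ S ∈ T, (E S).length = k.choose 2 := by
    intro S hS
    have hScard : #S = k := (mem_powersetCard.1 hS).2
    simp only [E, Finset.length_toList]
    rw [← hScard, ← card_filter_cliqueVec S]
    congr 1
    ext e
    simp only [mem_filter, mem_univ, true_and, cliqueVec_eq_true_iff]
  have hEne : ∀ S ∈ T, E S ≠ [] := by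
    intro S hS
    have := hElen S hS
    intro hnil
    rw [hnil, List.length_nil] at this
    have : 1 ≤ k.choose 2 := Nat.choose_pos h2
    omega
  have hTcard : #T = n.choose k := by rw [hT, card_powersetCard, card_univ, Fintype.card_fin]
  have hTne : T.Nonempty := powersetCard_nonempty.2 (by simpa using hkn)
  -- stage 1: all the ANDs in parallel
  have h1 : CktSize monotoneBasis
      (fun (x : Edges n → Bool) (S : T) => (E S).all fun e => x e) (∑ S : T, (E S).length) :=
    CktSize.pi fun S => cktSize_all (E S) (hEne S S.2)
  -- stage 2: the OR of the results
  have hUne : (univ : Finset T).toList ≠ [] := by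
    obtain ⟨S, hS⟩ := hTne
    intro hnil
    have := Finset.mem_toList.2 (mem_univ (⟨S, hS⟩ : T))
    rw [hnil] at this
    simp at this
  have h2 := h1.comp (cktSize_any (ι := T) (univ : Finset T).toList hUne)
  obtain ⟨C, hCB, hsize, hCev⟩ := h2.toCircuit
  refine ⟨C, hCB, ?_, fun x => ?_⟩
  · -- size bookkeeping
    refine hsize.trans (le_of_eq ?_)
    have hsum : ∑ S : T, (E S).length = n.choose k * k.choose 2 := by
      rw [Finset.sum_coe_sort T (fun S => (E S).length), Finset.sum_congr rfl hElen, sum_const,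
        hTcard, smul_eq_mul]
    rw [hsum, Finset.length_toList, card_univ, Fintype.card_coe, hTcard]
    ring
  · rw [hCev]
    apply Bool.eq_iff_iff.2
    rw [cliqueFn_eq_true_iff_exists, List.any_eq_true]
    constructor
    · rintro ⟨S, -, hS⟩
      rw [List.all_eq_true] at hS
      refine ⟨S, (mem_powersetCard.1 S.2).2, fun e he => hS e ?_⟩
      exact Finset.mem_toList.2 (mem_filter.2 ⟨mem_univ _, he⟩)
    · rintro ⟨S, hS, hx⟩
      have hST : S ∈ T := mem_powersetCard.2 ⟨subset_univ _, hS⟩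
      refine ⟨⟨S, hST⟩, Finset.mem_toList.2 (mem_univ _), ?_⟩
      rw [List.all_eq_true]
      intro e he
      exact hx e (mem_filter.1 (Finset.mem_toList.1 he)).2

/-- The exact circuit has size `≤ n^{k+2}` for `2 ≤ k ≤ n`. [folklore] -/
theorem choose_mul_le_pow {n k : ℕ} (h2 : 2 ≤ k) (hkn : k ≤ n) :
    n.choose k * (k.choose 2 + 1) ≤ n ^ (k + 2) := by
  have h1 : n.choose k ≤ n ^ k := Nat.choose_le_pow n k
  have h2' : k.choose 2 + 1 ≤ n ^ 2 := by
    have ha : k.choose 2 ≤ k * (k - 1) := by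
      rw [Nat.choose_two_right]; exact Nat.div_le_self _ _
    have hb : k * (k - 1) = k * k - k := Nat.mul_sub_one k k
    have hc : k ≤ k * k := Nat.le_mul_self k
    have hd : k * k ≤ n * n := Nat.mul_le_mul hkn hkn
    have he : n ^ 2 = n * n := sq n
    omega
  calc n.choose k * (k.choose 2 + 1) ≤ n ^ k * n ^ 2 := Nat.mul_le_mul h1 h2'
    _ = n ^ (k + 2) := (pow_add n k 2).symm

/-- **Every witness has `c ≤ k + 1`.** If `(k, δ)` with `δ ≥ 0` witnesses the crux at exponent
`c`, then `c < k + 2`: otherwise the exact DNF circuit (error `0`, size `≤ n^{k+2} ≤ n^c`)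
violates it for every `n ≥ k`. So `k(c) → ∞` is forced — the crux cannot be met with a bounded
clique size (Rossman's Thm 3 would even force `k ≥ 4c - O(1)`, not formalised). [folklore] -/
theorem witness_exponent_lt {c k : ℕ} {δ : ℝ} (hk : 2 ≤ k) (hδ : 0 ≤ δ) (h : LowerBoundAt c k δ) :
    c < k + 2 := by
  by_contra hc
  push Not at hc
  obtain ⟨n, hn, hnk⟩ := (h.and (eventually_ge_atTop (max k 2))).exists
  have hkn : k ≤ n := le_of_max_le_left hnk
  have hn2 : 2 ≤ n := le_of_max_le_right hnk
  obtain ⟨C, hCB, hsize, hCev⟩ := exists_monotone_cliqueCircuit hk hkn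
  have herr : err n k C ≤ δ := by
    have : (univ.filter fun x => C.eval x ≠ cliqueFn n k x) = ∅ := by
      simp [hCev]
    simp [err, this, gnpProb, hδ]
  have h1 := hn C hCB herr
  have h2 : C.size ≤ n ^ c :=
    (hsize.trans (choose_mul_le_pow hk hkn)).trans (Nat.pow_le_pow_right (by omega) hc)
  omega

/-- **Natural strengthening no. 2 — ONE clique size `k` for every exponent `c` — is FALSE** (exact
DNF circuit at `c = k + 2`). [folklore] -/
theorem not_singleThresholdKBeforeC :
    ¬ ∃ k : ℕ, 3 ≤ k ∧ ∃ δ : ℝ, 0 < δ ∧ ∀ c : ℕ, LowerBoundAt c k δ := by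
  rintro ⟨k, hk3, δ, hδ, H⟩
  have := witness_exponent_lt (c := k + 2) (by omega) hδ.le (H (k + 2))
  omega


end

end Summit.PneNP.PneNP.Theorems.SingleThreshold.Negative
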